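import Summits.QuantumFields.YangMills.Theorems.BalabanUVNodesN15KingModelComplexLinkNumericalRange
import HarnessLib
/-!
# BalabanUVNodes ∕ N15 — THE KING-MODEL RUNG (PART Ϛ-q): THE RESOLVENT HALF-PLANE ON THE COMPLEX WINDOW — for every spectral parameter `z` with `Re z < m² − 2(d+1)cε` and every two-sided field in
# the polydisc, `M_{U,V} − z` is invertible with `‖(M_{U,V} − z)⁻¹‖_{ℓ²→ℓ²} ≤ 1∕(m² − 2(d+1)cε − Re z)`: the mass, too, may be complexified, jointly with the link field (coercivity, PART Ϛ-m)
# (Track A, DAG node N15 = NE2; FAN-OUT v1.1 §N15 s3 «KING-MODEL RUNG … + what the curved case adds»; count-neutral)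
HONEST FRAMING.  Count-neutral (cell `pub-ymgap`, seat `pub-ymgap-dag-n15-e` g43; `--supports stmt-QuantumFields-27247 --as helper` = K3ᴬ, KEY MAP v3).  One finite torus at fixed
spacing; King's `A = 0` model, FINE covariance layer only; nothing of Bałaban's (3.42) ∕ Thm 3.4 for `G(U)` asserted; nothing continuum ∕ ℝ⁴ ∕ OS ∕ Clay; NOT a node discharge.
WHAT IS DECIDED.  [Balaban1985BackgroundPropagators] Thm 3.4 p.400 extends the propagators analytically in the field; [Balaban1984PropagatorsI]∕King vary the mass (King (4.4) p.670 with
`m² > 0`; PART Ϟ's mass calculus).  PART Ϛ-m proved the coercivity `Re⟨v, M_{U,V}v⟩ ≥ m′²‖v‖²`, `m′² = m² − 2(d+1)cε`, on the polydisc `‖U(b)‖, ‖V(b)‖ ≤ 1+ε` (`c ≥ 0`).  Hence, for a COMPLEX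
spectral ∕ mass shift `z : 𝕜`:
* §1 `re_quadForm_sub_smul` (`Re⟨v,(M − z)v⟩ = Re⟨v,Mv⟩ − Re z·‖v‖²`), ★★ **`re_quadForm_cxLapF_sub_smul_ge`** (COERCIVITY OF THE SHIFTED OPERATOR: `≥ (m′² − Re z)‖v‖²`), ★★ `norm_toLp_cxLapF_sub_smul_mulVec_ge`
  (Lax–Milgram: `(m′² − Re z)‖v‖ ≤ ‖(M − z)v‖`);
* §2 ★★★ **`isUnit_cxLapF_sub_smul`** — `Re z < m′²` ⟹ `M_{U,V} − z·1` invertible: THE HALF-PLANE `{Re z < m² − 2(d+1)cε}` LIES IN THE RESOLVENT SET, uniformly in the volume, the fibre and the field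
  (in particular the SPECTRUM has `Re λ ≥ m′²`, re-deriving Ϛ-g `shifted_mass_le_re_eigenvalue` from the numerical range); ★★★ **`norm_toLp_cxLapF_sub_smul_inv_mulVec_le`** ∕ ★★★
  **`l2_opNorm_cxLapF_sub_smul_inv_le`** — THE RESOLVENT BOUND `‖(M_{U,V} − z)⁻¹‖_{ℓ²→ℓ²} ≤ 1∕(m′² − Re z)`;
* §3 ★★ `isUnit_cxLapF_sub_smul_of_norm_lt` (the disc `‖z‖ < m′²` — complex MASS perturbations `m² ↦ m² − z` of size below the shifted mass), ★ `isUnit_covLapF_sub_smul` (unitary `U`, ε = 0: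
  `{Re z < m²} ⊆ ρ(−cΔ_U+m²)`, consistent with Ͱ-f's spectrum `⊆ [m², m²+4(d+1)c]`).
PRIOR TREE ART (by name): Ϛ-m (`re_quadForm_cxLapF_ge`, `star_dotProduct_self`, `norm_star_dotProduct_le`, `star_dotProduct_eq_inner`), Ϛ-b (`shifted_mass_pos`, `unitary_mem_window`), Ϛ-a (`cxLapF_adjoint`),
Mathlib (`Matrix.mulVec_injective_iff_isUnit`, `Matrix.cstar_norm_def`, `ContinuousLinearMap.opNorm_le_bound`, `Matrix.toEuclideanCLM_toLp`).  Dedup (rg at filing): basename 0 files; needles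
`cxLapF_sub_smul|quadForm_sub_smul` 0 tree files.  Locators: [Balaban1985BackgroundPropagators] Thm 3.4 p.400, (3.46) p.398; [King1986] (4.4) p.670.  0 `sorry`, 0 `def`.
-/

noncomputable section
open scoped BigOperators ComplexConjugate ComplexOrder Matrix.Norms.L2Operator InnerProductSpace
open Finset Matrix WithLp

namespace Summit.QuantumFields.YangMills.BalabanUVNodes.N15KingModelRung.Covariant

open Literature.MathematicalPhysics.QuantumFieldTheory.LatticeDiamagneticInequality (Hopping blk)
open Literature.MathematicalPhysics.QuantumFieldTheory.Balaban1983to89.B5Prop11Plancherel (Tor unitVec)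
open Literature.MathematicalPhysics.QuantumFieldTheory.King1986.Torus (lapF)

variable {d : ℕ} (K : Fin (d + 1) → ℕ) [hK : ∀ μ, NeZero (K μ)]
variable {𝕜 : Type*} [RCLike 𝕜] {n : Type*} [Fintype n] [DecidableEq n] {c m2 ε : ℝ}

/-! ## §1 Coercivity of the shifted operator `M_{U,V} − z` -/

/-- `Re⟨v, (A − z·1)v⟩ = Re⟨v, Av⟩ − Re z·‖v‖²`. [folklore] -/
theorem re_quadForm_sub_smul (A : Matrix (Tor K × n) (Tor K × n) 𝕜) (z : 𝕜) (v : Tor K × n → 𝕜) :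
    RCLike.re (star v ⬝ᵥ ((A - z • (1 : Matrix (Tor K × n) (Tor K × n) 𝕜)) *ᵥ v))
      = RCLike.re (star v ⬝ᵥ (A *ᵥ v)) - RCLike.re z * ‖(toLp 2 v : EuclideanSpace 𝕜 (Tor K × n))‖ ^ 2 := by
  rw [Matrix.sub_mulVec, dotProduct_sub, map_sub, Matrix.smul_mulVec, Matrix.one_mulVec, dotProduct_smul, smul_eq_mul, star_dotProduct_self,
    ← RCLike.ofReal_pow, RCLike.re_mul_ofReal]

/-- ★★ **COERCIVITY OF THE SHIFTED OPERATOR**: on the polydisc (`c ≥ 0`, `‖U(b)‖, ‖V(b)‖ ≤ 1+ε`) and for every `z : 𝕜`,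
`Re⟨v, (M_{U,V} − z)v⟩ ≥ (m² − 2(d+1)cε − Re z)·‖v‖²`. [cite: Balaban1985BackgroundPropagators, Thm 3.4 p.400; King1986, (4.4) p.670] -/
theorem re_quadForm_cxLapF_sub_smul_ge (hc : 0 ≤ c) (m2 : ℝ) {U V : Tor K × Fin (d + 1) → Matrix n n 𝕜} (hU : ∀ b, ‖U b‖ ≤ 1 + ε) (hV : ∀ b, ‖V b‖ ≤ 1 + ε)
    (z : 𝕜) (v : Tor K × n → 𝕜) :
    (m2 - 2 * ((d : ℝ) + 1) * c * ε - RCLike.re z) * ‖(toLp 2 v : EuclideanSpace 𝕜 (Tor K × n))‖ ^ 2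
      ≤ RCLike.re (star v ⬝ᵥ ((cxLapF K c m2 U V - z • (1 : Matrix (Tor K × n) (Tor K × n) 𝕜)) *ᵥ v)) := by
  rw [re_quadForm_sub_smul, sub_mul]
  exact sub_le_sub_right (re_quadForm_cxLapF_ge K hc m2 hU hV v) _

/-- ★★ **LAX–MILGRAM FOR THE SHIFTED OPERATOR**: `(m′² − Re z)·‖v‖ ≤ ‖(M_{U,V} − z)v‖` whenever `Re z ≤ m′²` (indeed for all `z`, trivially when the constant is `≤ 0`).
[cite: Balaban1985BackgroundPropagators, Thm 3.4 p.400, (3.46) p.398] -/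
theorem norm_toLp_cxLapF_sub_smul_mulVec_ge (hc : 0 ≤ c) (m2 : ℝ) {U V : Tor K × Fin (d + 1) → Matrix n n 𝕜} (hU : ∀ b, ‖U b‖ ≤ 1 + ε) (hV : ∀ b, ‖V b‖ ≤ 1 + ε)
    {z : 𝕜} (hz : RCLike.re z ≤ m2 - 2 * ((d : ℝ) + 1) * c * ε) (v : Tor K × n → 𝕜) :
    (m2 - 2 * ((d : ℝ) + 1) * c * ε - RCLike.re z) * ‖(toLp 2 v : EuclideanSpace 𝕜 (Tor K × n))‖
      ≤ ‖(toLp 2 ((cxLapF K c m2 U V - z • (1 : Matrix (Tor K × n) (Tor K × n) 𝕜)) *ᵥ v) : EuclideanSpace 𝕜 (Tor K × n))‖ := by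
  set N : ℝ := ‖(toLp 2 v : EuclideanSpace 𝕜 (Tor K × n))‖ with hN
  have hδ : 0 ≤ m2 - 2 * ((d : ℝ) + 1) * c * ε - RCLike.re z := by linarith
  by_cases hv : N = 0
  · rw [hv, mul_zero]; exact norm_nonneg _
  have hNpos : 0 < N := lt_of_le_of_ne (norm_nonneg _) (Ne.symm hv)
  have h1 := re_quadForm_cxLapF_sub_smul_ge K hc m2 hU hV z v
  have h2 : RCLike.re (star v ⬝ᵥ ((cxLapF K c m2 U V - z • (1 : Matrix (Tor K × n) (Tor K × n) 𝕜)) *ᵥ v))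
      ≤ N * ‖(toLp 2 ((cxLapF K c m2 U V - z • (1 : Matrix (Tor K × n) (Tor K × n) 𝕜)) *ᵥ v) : EuclideanSpace 𝕜 (Tor K × n))‖ :=
    (RCLike.re_le_norm _).trans (norm_star_dotProduct_le K v _)
  have h3 : (m2 - 2 * ((d : ℝ) + 1) * c * ε - RCLike.re z) * N * N
      ≤ ‖(toLp 2 ((cxLapF K c m2 U V - z • (1 : Matrix (Tor K × n) (Tor K × n) 𝕜)) *ᵥ v) : EuclideanSpace 𝕜 (Tor K × n))‖ * N := by nlinarith [h1, h2]
  exact le_of_mul_le_mul_right h3 hNpos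

/-! ## §2 The resolvent half-plane -/

/-- ★★★ **THE HALF-PLANE `Re z < m² − 2(d+1)cε` LIES IN THE RESOLVENT SET OF `M_{U,V}`**, for every two-sided field in the polydisc (`c ≥ 0`): `M_{U,V} − z·1` is invertible.  The mass
parameter may thus be complexified jointly with the link field. [cite: Balaban1985BackgroundPropagators, Thm 3.4 p.400; King1986, (4.4) p.670] -/
theorem isUnit_cxLapF_sub_smul (hc : 0 ≤ c) (m2 : ℝ) {U V : Tor K × Fin (d + 1) → Matrix n n 𝕜} (hU : ∀ b, ‖U b‖ ≤ 1 + ε) (hV : ∀ b, ‖V b‖ ≤ 1 + ε)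
    {z : 𝕜} (hz : RCLike.re z < m2 - 2 * ((d : ℝ) + 1) * c * ε) :
    IsUnit (cxLapF K c m2 U V - z • (1 : Matrix (Tor K × n) (Tor K × n) 𝕜)) := by
  refine Matrix.mulVec_injective_iff_isUnit.mp fun v w h => ?_
  rw [← sub_eq_zero]
  have hδ : 0 < m2 - 2 * ((d : ℝ) + 1) * c * ε - RCLike.re z := by linarith
  have h0 : (cxLapF K c m2 U V - z • (1 : Matrix (Tor K × n) (Tor K × n) 𝕜)) *ᵥ (v - w) = 0 := by
    rw [Matrix.mulVec_sub]; exact sub_eq_zero.mpr h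
  have h1 := norm_toLp_cxLapF_sub_smul_mulVec_ge K hc m2 hU hV hz.le (v - w)
  rw [h0, WithLp.toLp_zero, norm_zero] at h1
  have hN : ‖(toLp 2 (v - w) : EuclideanSpace 𝕜 (Tor K × n))‖ = 0 := by
    have := norm_nonneg (toLp 2 (v - w) : EuclideanSpace 𝕜 (Tor K × n))
    nlinarith
  have h2 : (toLp 2 (v - w) : EuclideanSpace 𝕜 (Tor K × n)) = 0 := norm_eq_zero.mp hN
  have h3 := congrArg WithLp.ofLp h2
  simpa only [WithLp.ofLp_toLp, WithLp.ofLp_zero] using h3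

/-- ★★★ **THE RESOLVENT BOUND, VECTOR FORM**: `Re z < m′²` ⟹ `‖(M_{U,V} − z)⁻¹w‖ ≤ ‖w‖∕(m′² − Re z)` on the polydisc. [cite: Balaban1985BackgroundPropagators, Thm 3.4 p.400, (3.46) p.398] -/
theorem norm_toLp_cxLapF_sub_smul_inv_mulVec_le (hc : 0 ≤ c) (m2 : ℝ) {U V : Tor K × Fin (d + 1) → Matrix n n 𝕜} (hU : ∀ b, ‖U b‖ ≤ 1 + ε) (hV : ∀ b, ‖V b‖ ≤ 1 + ε)
    {z : 𝕜} (hz : RCLike.re z < m2 - 2 * ((d : ℝ) + 1) * c * ε) (w : Tor K × n → 𝕜) :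
    ‖(toLp 2 ((cxLapF K c m2 U V - z • (1 : Matrix (Tor K × n) (Tor K × n) 𝕜))⁻¹ *ᵥ w) : EuclideanSpace 𝕜 (Tor K × n))‖
      ≤ (m2 - 2 * ((d : ℝ) + 1) * c * ε - RCLike.re z)⁻¹ * ‖(toLp 2 w : EuclideanSpace 𝕜 (Tor K × n))‖ := by
  have hδ : 0 < m2 - 2 * ((d : ℝ) + 1) * c * ε - RCLike.re z := by linarith
  have hdet : IsUnit (cxLapF K c m2 U V - z • (1 : Matrix (Tor K × n) (Tor K × n) 𝕜)).det :=
    (Matrix.isUnit_iff_isUnit_det _).mp (isUnit_cxLapF_sub_smul K hc m2 hU hV hz)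
  set v := (cxLapF K c m2 U V - z • (1 : Matrix (Tor K × n) (Tor K × n) 𝕜))⁻¹ *ᵥ w with hv
  have hMv : (cxLapF K c m2 U V - z • (1 : Matrix (Tor K × n) (Tor K × n) 𝕜)) *ᵥ v = w := by
    rw [hv, mulVec_mulVec, Matrix.mul_nonsing_inv _ hdet, one_mulVec]
  have h := norm_toLp_cxLapF_sub_smul_mulVec_ge K hc m2 hU hV hz.le v
  rw [hMv] at h
  rw [inv_mul_eq_div, le_div_iff₀ hδ, mul_comm]
  exact h

/-- ★★★ **THE RESOLVENT BOUND IN OPERATOR NORM**: for `c ≥ 0`, every two-sided field with `‖U(b)‖, ‖V(b)‖ ≤ 1+ε` and every `z` with `Re z < m² − 2(d+1)cε`: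
`‖(M_{U,V} − z)⁻¹‖_{ℓ²→ℓ²} ≤ 1∕(m² − 2(d+1)cε − Re z)`, uniformly in the volume, the fibre and the field. [cite: Balaban1985BackgroundPropagators, Thm 3.4 p.400, (3.46) p.398; King1986, (4.4) p.670] -/
theorem l2_opNorm_cxLapF_sub_smul_inv_le (hc : 0 ≤ c) (m2 : ℝ) {U V : Tor K × Fin (d + 1) → Matrix n n 𝕜} (hU : ∀ b, ‖U b‖ ≤ 1 + ε) (hV : ∀ b, ‖V b‖ ≤ 1 + ε)
    {z : 𝕜} (hz : RCLike.re z < m2 - 2 * ((d : ℝ) + 1) * c * ε) :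
    ‖(cxLapF K c m2 U V - z • (1 : Matrix (Tor K × n) (Tor K × n) 𝕜))⁻¹‖ ≤ (m2 - 2 * ((d : ℝ) + 1) * c * ε - RCLike.re z)⁻¹ := by
  have hδ : 0 < m2 - 2 * ((d : ℝ) + 1) * c * ε - RCLike.re z := by linarith
  rw [Matrix.cstar_norm_def]
  refine ContinuousLinearMap.opNorm_le_bound _ (inv_nonneg.mpr hδ.le) fun w => ?_
  have hw : w = toLp 2 (ofLp w) := rfl
  rw [hw, Matrix.toEuclideanCLM_toLp]
  exact norm_toLp_cxLapF_sub_smul_inv_mulVec_le K hc m2 hU hV hz (ofLp w)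

/-! ## §3 Complex mass perturbations; the unitary slice -/

/-- ★★ **COMPLEX MASS PERTURBATIONS BELOW THE SHIFTED MASS**: `‖z‖ < m² − 2(d+1)cε` ⟹ `M_{U,V} − z` invertible (the operator with COMPLEX mass `m² − z` on the polydisc).
[cite: Balaban1985BackgroundPropagators, Thm 3.4 p.400; King1986, (4.4) p.670] -/
theorem isUnit_cxLapF_sub_smul_of_norm_lt (hc : 0 ≤ c) (m2 : ℝ) {U V : Tor K × Fin (d + 1) → Matrix n n 𝕜} (hU : ∀ b, ‖U b‖ ≤ 1 + ε) (hV : ∀ b, ‖V b‖ ≤ 1 + ε)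
    {z : 𝕜} (hz : ‖z‖ < m2 - 2 * ((d : ℝ) + 1) * c * ε) :
    IsUnit (cxLapF K c m2 U V - z • (1 : Matrix (Tor K × n) (Tor K × n) 𝕜)) :=
  isUnit_cxLapF_sub_smul K hc m2 hU hV (lt_of_le_of_lt (RCLike.re_le_norm z) hz)

/-- ★ **THE UNITARY SLICE**: for `c ≥ 0`, unitary `U` and `Re z < m²`, `−cΔ_U + m² − z` is invertible — `{Re z < m²}` lies in the resolvent set of PART Ͱ's operator (consistent with Ͱ-f's spectrum
`⊆ [m², m²+4(d+1)c]`). [cite: King1986, (4.4) p.670; Balaban1985BackgroundPropagators, (3.23) p.394] -/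
theorem isUnit_covLapF_sub_smul (hc : 0 ≤ c) (m2 : ℝ) {U : Tor K × Fin (d + 1) → Matrix n n 𝕜} (hU : ∀ b, U b ∈ Matrix.unitaryGroup n 𝕜)
    {z : 𝕜} (hz : RCLike.re z < m2) :
    IsUnit (covLapF K c m2 U - z • (1 : Matrix (Tor K × n) (Tor K × n) 𝕜)) := by
  have hz' : RCLike.re z < m2 - 2 * ((d : ℝ) + 1) * c * 0 := by rwa [mul_zero, sub_zero]
  have h := isUnit_cxLapF_sub_smul K hc m2 (unitary_mem_window K hU).1 (unitary_mem_window K hU).2 hz'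
  rwa [cxLapF_adjoint] at h

end Summit.QuantumFields.YangMills.BalabanUVNodes.N15KingModelRung.Covariant

end
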